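import Summits.BirchSwinnertonDyer.BirchSwinnertonDyer.Theorems.ResidualThetaTransportAtTwoSignedMuVanishingAtTwoPlusSexticReading
import Literature.NumberTheory.EllipticCurves.Castella2018.AnticyclotomicSelmerDual
import Literature.NumberTheory.EllipticCurves.HeegnerPoints
import Mathlib.Algebra.Polynomial.Eval.Defs
import HarnessLib

/-!
# Crux-ideate k1 g12 — sketch for the idea card `split-twist-transfer` (crux item stmt-BirchSwinnertonDyer-21438,
# decl `ResidualThetaTransportAtTwo.SignedMuSeedAtTwoPlus`). NOT a skeleton; nothing is registered. BSD is not proved by this.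

(L1) `parallel_line_rigidity` — PROVED algebra: for `G ∈ R[S]` (`R` models `𝒪'⟦T⟧`, the cyclotomic variable lives in `R`),
`ϖ ∣ s ⟹ ϖ ∣ G(s) − G(0)`; hence `ϖ ∤ G(0) ⟹ ϖ ∤ G(s)`: the `μ`-vanishing status of EVERY cyclotomic line `S = s`, `s ∈ ϖ𝒪'`,
of a two-variable function is the single bit "is `S = 0` non-exceptional".
(L2) `FineOfSplitStrictMuZero` — the TRANSFER statement (first stub of the line, typed over tree carriers): a `Λ`-torsion,
`μ = 0` CYCLOTOMIC-line `𝔮̄`-strict / `𝔮`-relaxed Selmer dual of `W` over an auxiliary imaginary quadratic `K'` with `2` SPLIT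
forces `Sel₀(W/ℚ_∞)[2]` finite.
(L3) `SplitStrictMuZeroOnHabitat` — the transferred crux `C⁺` on the habitat⁺.
(L4) `fineResidual_of`, `fineHalf_of` — plumbing: (L2) + (L3) ⟹ the class-group half (F) of the seed (via the tree's
`classicalMuVanishes_divisionField_two_of_fineResidualFinite`, conditional on the print fact `hG`).
-/

open scoped Classical
open NumberField IsDedekindDomain Field WeierstrassCurve
open Literature.NumberTheory.EllipticCurves Literature.NumberTheory.EllipticCurves.Rank1Residual
open Literature.NumberTheory.EllipticCurves.IwasawaAlgebra
open Literature.NumberTheory.EllipticCurves.Castella2018.AcSelmer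
open Literature.NumberTheory.IwasawaTheory

namespace Summit.BirchSwinnertonDyer.BirchSwinnertonDyer.Cruxes.SignedMuSeedAtTwoPlus.SplitTwistTransfer

/-! ## (L1) parallel-line rigidity -/

/-- For `G ∈ R[S]` and `ϖ ∣ s`: `ϖ ∣ G(s) − G(0)`. -/
theorem parallel_line_rigidity {R : Type*} [CommRing R] (ϖ s : R) (hs : ϖ ∣ s) (G : Polynomial R) :
    ϖ ∣ G.eval s - G.eval 0 := by
  have h := Polynomial.sub_dvd_eval_sub s 0 G
  rw [sub_zero] at h
  exact dvd_trans hs h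

/-- If the line `S = 0` is non-exceptional (`ϖ ∤ G(0)`), so is every parallel line `S = s`, `s ∈ (ϖ)`. -/
theorem not_dvd_eval_of_not_dvd_eval_zero {R : Type*} [CommRing R] (ϖ s : R) (hs : ϖ ∣ s)
    (G : Polynomial R) (h0 : ¬ ϖ ∣ G.eval 0) : ¬ ϖ ∣ G.eval s := by
  intro h
  have h' : ϖ ∣ G.eval s - (G.eval s - G.eval 0) := dvd_sub h (parallel_line_rigidity ϖ s hs G)
  rw [sub_sub_cancel] at h'
  exact h0 h'

/-- Conversely an exceptional base line makes every parallel line exceptional: the bit is well defined. -/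
theorem dvd_eval_iff_dvd_eval_zero {R : Type*} [CommRing R] (ϖ s : R) (hs : ϖ ∣ s) (G : Polynomial R) :
    ϖ ∣ G.eval s ↔ ϖ ∣ G.eval 0 := by
  refine ⟨fun h ↦ ?_, fun h0 ↦ ?_⟩
  · have h' : ϖ ∣ G.eval s - (G.eval s - G.eval 0) := dvd_sub h (parallel_line_rigidity ϖ s hs G)
    rwa [sub_sub_cancel] at h'
  · have h' := dvd_add h0 (parallel_line_rigidity ϖ s hs G)
    rwa [add_sub_cancel] at h'

/-! ## (L2) the transfer statement -/

/-- **T1 (transfer, size M; restriction + "fine ⊂ every Selmer structure" + structure theory).** For `W/ℚ` good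
supersingular at `2`, `K'` imaginary quadratic with `2 = 𝔮𝔮̄` SPLIT, `𝔮̄ ∋ 2` a prime of `K'`, `κ'` a CYCLOTOMIC
`ℤ₂`-extension of `K'` with topological generator `γ'`: if the `𝔮̄`-strict, `𝔮`-relaxed Selmer dual
`X := XAc (W/K') 2 κ' 𝔮̄ ∅ γ'` over `K'·ℚ_∞` is finitely generated `Λ`-torsion with `μ(X) = 0`, then `Sel₀(W/ℚ_∞)[2]` is
finite for every cyclotomic `ℤ₂`-extension `κ` of `ℚ` (restriction `ℚ_∞ → K'ℚ_∞` has finite kernel; fine classes are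
trivial at `𝔮̄` and at every `w ∤ 2`; a quotient-up-to-finite of a torsion `μ = 0` module has finite `2`-torsion dual). -/
def FineOfSplitStrictMuZero : Prop :=
  ∀ (W : WeierstrassCurve ℚ) [W.IsElliptic] [W.IsGloballyMinimal], GoodSS W 2 →
    ∀ (K' : Type) [Field K'] [NumberField K'], IsImaginaryQuadratic K' →
      ((Ideal.span {(2 : ℤ)}).primesOver (𝓞 K')).ncard = 2 →
      ∀ (𝔮 : HeightOneSpectrum (𝓞 K')), ((2 : ℕ) : 𝓞 K') ∈ 𝔮.asIdeal →
      ∀ (κ' : ZpExtension K' 2) (γ' : absoluteGaloisGroup K') [Fact (κ'.IsTopGenerator γ')], κ'.IsCyclotomic →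
        ∀ [Module.Finite (IwasawaAlgebra 2) (XAc (W.baseChange K') 2 κ' 𝔮 ∅ γ')],
          Module.IsTorsion (IwasawaAlgebra 2) (XAc (W.baseChange K') 2 κ' 𝔮 ∅ γ') →
          muInvariant 2 (XAc (W.baseChange K') 2 κ' 𝔮 ∅ γ') = 0 →
            ∀ κ : ZpExtension ℚ 2, κ.IsCyclotomic → {s : W.fineSelmerInfty κ | 2 • s = 0}.Finite

/-! ## (L3) the transferred crux `C⁺` on the habitat⁺ -/

/-- **C⁺ (the split-twist form of the class-group half).** For every habitat⁺ curve `W` there is an auxiliary imaginary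
quadratic field `K'` in which `2` SPLITS, a prime `𝔮̄ ∣ 2` of `K'`, a cyclotomic `ℤ₂`-extension `κ'` of `K'` and a topological
generator, such that the `𝔮̄`-strict / `𝔮`-relaxed Selmer dual of `W` over `K'ℚ_∞` is finitely generated `Λ`-torsion with
`μ = 0`. (Intended `K' = ℚ(√(Δ_W·d))`, `d > 0` squarefree, `d ≡ 5 (mod 8)`, every `ℓ ∣ N_W` split in `K'`.) -/
def SplitStrictMuZeroOnHabitat : Prop :=
  ∀ (W : WeierstrassCurve ℚ) [W.IsElliptic] [W.IsGloballyMinimal], ¬ W.HasCM → W.analyticRank = 0 →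
    GoodSS W 2 → W.frobeniusTrace 2 = 0 → W.Δ < 0 →
    ∃ (K' : Type) (_ : Field K') (_ : NumberField K'), IsImaginaryQuadratic K' ∧
      ((Ideal.span {(2 : ℤ)}).primesOver (𝓞 K')).ncard = 2 ∧
      ∃ (𝔮 : HeightOneSpectrum (𝓞 K')), ((2 : ℕ) : 𝓞 K') ∈ 𝔮.asIdeal ∧
      ∃ (κ' : ZpExtension K' 2) (γ' : absoluteGaloisGroup K') (_ : Fact (κ'.IsTopGenerator γ')), κ'.IsCyclotomic ∧
        ∃ (_ : Module.Finite (IwasawaAlgebra 2) (XAc (W.baseChange K') 2 κ' 𝔮 ∅ γ')),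
          Module.IsTorsion (IwasawaAlgebra 2) (XAc (W.baseChange K') 2 κ' 𝔮 ∅ γ') ∧
          muInvariant 2 (XAc (W.baseChange K') 2 κ' 𝔮 ∅ γ') = 0

/-! ## (L4) plumbing to the class-group half (F) -/

/-- (L2) + (L3) ⟹ residual Conjecture A at `2` on the habitat⁺. -/
theorem fineResidual_of (h1 : FineOfSplitStrictMuZero) (h2 : SplitStrictMuZeroOnHabitat) :
    ∀ (W : WeierstrassCurve ℚ) [W.IsElliptic] [W.IsGloballyMinimal], ¬ W.HasCM → W.analyticRank = 0 →
      GoodSS W 2 → W.frobeniusTrace 2 = 0 → W.Δ < 0 →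
      ∀ κ : ZpExtension ℚ 2, κ.IsCyclotomic → {s : W.fineSelmerInfty κ | 2 • s = 0}.Finite := by
  intro W _ _ hCM hr hss ha hΔ κ hκ
  obtain ⟨K', _, _, hK, hsplit, 𝔮, h𝔮, κ', γ', _, hκ', _, htor, hμ⟩ := h2 W hCM hr hss ha hΔ
  exact h1 W hss K' hK hsplit 𝔮 h𝔮 κ' γ' hκ' htor hμ κ hκ

/-- (L2) + (L3) ⟹ the class-group half (F): Iwasawa's `μ₂ = 0` for `ℚ(W[2])^{cyc}` on the habitat⁺ (granted `hG`). -/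
theorem fineHalf_of
    (hG : Literature.NumberTheory.EllipticCurves.prop416_classicalMuVanishes_divisionField_two_of_fineSelmer_twoTorsion_finite)
    (h1 : FineOfSplitStrictMuZero) (h2 : SplitStrictMuZeroOnHabitat) :
    ∀ (W : WeierstrassCurve ℚ) [W.IsElliptic] [W.IsGloballyMinimal], ¬ W.HasCM → W.analyticRank = 0 →
      GoodSS W 2 → W.frobeniusTrace 2 = 0 → W.Δ < 0 →
      ∀ κM : ZpExtension (W.divisionField 2) 2, κM.IsCyclotomic → ClassicalMuVanishes κM := by
  intro W _ _ hCM hr hss ha hΔ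
  exact Summit.BirchSwinnertonDyer.BirchSwinnertonDyer.Theorems.SignedMuAtTwo.classicalMuVanishes_divisionField_two_of_fineResidualFinite
    hG W hss hΔ (CyclotomicZp.zpExtension 2) (CyclotomicZp.isCyclotomic_zpExtension 2)
    (fineResidual_of h1 h2 W hCM hr hss ha hΔ _ (CyclotomicZp.isCyclotomic_zpExtension 2))

end Summit.BirchSwinnertonDyer.BirchSwinnertonDyer.Cruxes.SignedMuSeedAtTwoPlus.SplitTwistTransfer
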